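import Summits.HubbardSuperconductivity.HubbardSuperconductivity.Theorems.AnisotropyChordTransferFibre3FamilyALemmas

/-!
# Route `AnisotropyChord` / H0 rotor rung: PartN38 — the convexity `HConvex` of the far-row profile PROVED

Typed target `HConvex` of `…Fibre3FamilyALemmas` (PORT PartN38, theory seat `hubbard-h0-rotor-theory-1` g21, memo 21 §316):
for `0 < b ≤ 1`, `h_b(u) = 1/(4√(b² − cos²u))` is convex on `(arccos b, π − arccos b)`.
Proof: on that interval `cos²u < b²`; with `g = b² − cos²u`, `h' = −cos u sin u/(4 g √g)` and
`h'' = [(sin²u − cos²u)·g + 3cos²u sin²u]/(g^{5/2})` up to a positive factor, and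
`(1 − 2x)(b² − x) + 3x(1 − x) = b² − x² + 2x(1 − b²) ≥ 0` for `x = cos²u < b² ≤ 1`; then `convexOn_of_deriv2_nonneg`.
Prover seat `hubbard-h0-rotor-p1` g23; helper for stmt-HubbardSuperconductivity-19089 (`--supports`).
-/

set_option linter.dupNamespace false
set_option autoImplicit false

noncomputable section

namespace Summit.HubbardSuperconductivity.HubbardSuperconductivity.Theorems.AnisotropyChord.Transfer.Fibre3

/-- `d/du (b² − cos²u) = 2 cos u sin u`. [folklore] -/
theorem hasDerivAt_gb (b u : ℝ) : HasDerivAt (fun u => b ^ 2 - Real.cos u ^ 2) (2 * Real.cos u * Real.sin u) u := by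
  have h := (hasDerivAt_const u (b ^ 2)).sub ((Real.hasDerivAt_cos u).pow 2)
  refine h.congr_deriv ?_
  simp only [show (2 : ℕ) - 1 = 1 from rfl, pow_one]
  push_cast
  ring

/-- the first derivative of `h_b`: `h_b'(u) = −cos u sin u/(4 (b² − cos²u) √(b² − cos²u))`. [folklore] -/
theorem hasDerivAt_hb (b u : ℝ) (hg : 0 < b ^ 2 - Real.cos u ^ 2) :
    HasDerivAt (fun u => 1 / (4 * Real.sqrt (b ^ 2 - Real.cos u ^ 2)))
      (-(Real.cos u * Real.sin u) / (4 * (b ^ 2 - Real.cos u ^ 2) * Real.sqrt (b ^ 2 - Real.cos u ^ 2))) u := by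
  have hsq := (hasDerivAt_gb b u).sqrt hg.ne'
  have h4 := hsq.const_mul (4 : ℝ)
  have hr0 : 0 < Real.sqrt (b ^ 2 - Real.cos u ^ 2) := Real.sqrt_pos.mpr hg
  have hne : 4 * Real.sqrt (b ^ 2 - Real.cos u ^ 2) ≠ 0 := by positivity
  have hf := (hasDerivAt_const u (1 : ℝ)).div h4 hne
  refine hf.congr_deriv ?_
  set r := Real.sqrt (b ^ 2 - Real.cos u ^ 2) with hr
  have hrr : r ^ 2 = b ^ 2 - Real.cos u ^ 2 := Real.sq_sqrt hg.le
  field_simp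
  linear_combination (Real.cos u * Real.sin u) * hrr

/-- the derivative of `h_b'` exists and is non-negative where `cos²u < b² ≤ 1`. [folklore] -/
theorem hasDerivAt_hb'_nonneg (b u : ℝ) (hb0 : 0 < b) (hb1 : b ≤ 1) (hg : 0 < b ^ 2 - Real.cos u ^ 2) :
    ∃ d : ℝ, HasDerivAt (fun u => -(Real.cos u * Real.sin u)
        / (4 * (b ^ 2 - Real.cos u ^ 2) * Real.sqrt (b ^ 2 - Real.cos u ^ 2))) d u ∧ 0 ≤ d := by
  have hN := ((Real.hasDerivAt_cos u).mul (Real.hasDerivAt_sin u)).neg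
  have hg' := hasDerivAt_gb b u
  have hsq := hg'.sqrt hg.ne'
  have hM := (hg'.const_mul (4 : ℝ)).mul hsq
  have hr0 : 0 < Real.sqrt (b ^ 2 - Real.cos u ^ 2) := Real.sqrt_pos.mpr hg
  have hMne : 4 * (b ^ 2 - Real.cos u ^ 2) * Real.sqrt (b ^ 2 - Real.cos u ^ 2) ≠ 0 := by positivity
  have hdiv := hN.div hM hMne
  refine ⟨_, hdiv, ?_⟩
  set r := Real.sqrt (b ^ 2 - Real.cos u ^ 2) with hr
  set c := Real.cos u with hc
  set s := Real.sin u with hs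
  have hrr : r ^ 2 = b ^ 2 - c ^ 2 := Real.sq_sqrt hg.le
  have hsc : s ^ 2 + c ^ 2 = 1 := Real.sin_sq_add_cos_sq u
  apply div_nonneg _ (sq_nonneg _)
  simp only [Pi.mul_apply, Pi.neg_apply]
  simp only [← hc, ← hs, ← hr]
  have key : -(-s * s + c * c) * (4 * (b ^ 2 - c ^ 2) * r)
        - -(c * s) * (4 * (2 * c * s) * r + 4 * (b ^ 2 - c ^ 2) * (2 * c * s / (2 * r)))
      = 4 * (b ^ 2 - c ^ 2) * ((b ^ 2 - c ^ 2) * (s ^ 2 - c ^ 2) + 3 * c ^ 2 * s ^ 2) / r := by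
    field_simp
    linear_combination ((s ^ 2 - c ^ 2) * (b ^ 2 - c ^ 2) + 2 * s ^ 2 * c ^ 2) * hrr
  rw [key]
  have hcb : c ^ 2 < b ^ 2 := by linarith
  have hb2 : b ^ 2 ≤ 1 := by nlinarith
  have hc2 : 0 ≤ c ^ 2 := sq_nonneg c
  have hE : 0 ≤ (b ^ 2 - c ^ 2) * (s ^ 2 - c ^ 2) + 3 * c ^ 2 * s ^ 2 := by
    have hs2 : s ^ 2 = 1 - c ^ 2 := by linarith
    rw [hs2]
    nlinarith [mul_nonneg hc2 (sub_nonneg.2 hb2), mul_nonneg (sq_nonneg b) (sub_nonneg.2 hcb.le),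
      mul_nonneg hc2 (sub_nonneg.2 hcb.le)]
  exact div_nonneg (mul_nonneg (by linarith) hE) hr0.le


/-- ★ **`HConvex` holds.** [folklore] -/
theorem hConvex_holds : HConvex := by
  intro b hb0 hb1
  have hD : {u : ℝ | Real.arccos b < u ∧ u < Real.pi - Real.arccos b} = Set.Ioo (Real.arccos b) (Real.pi - Real.arccos b) := rfl
  rw [hD]
  -- `cos² u < b²` on the interval
  have hgpos : ∀ u ∈ Set.Ioo (Real.arccos b) (Real.pi - Real.arccos b), 0 < b ^ 2 - Real.cos u ^ 2 := by
    intro u hu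
    obtain ⟨h1, h2⟩ := hu
    have ha0 : 0 ≤ Real.arccos b := Real.arccos_nonneg b
    have haπ : Real.arccos b ≤ Real.pi := Real.arccos_le_pi b
    have hcb : Real.cos (Real.arccos b) = b := Real.cos_arccos (by linarith) hb1
    have hlt : Real.cos u < b := by
      have := Real.cos_lt_cos_of_nonneg_of_le_pi ha0 (by linarith) h1
      rwa [hcb] at this
    have hgt : -b < Real.cos u := by
      have := Real.cos_lt_cos_of_nonneg_of_le_pi (by linarith) (by linarith) h2
      rwa [Real.cos_pi_sub, hcb] at this
    have := sq_lt_sq' hgt hlt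
    linarith
  have hd1 : ∀ u ∈ Set.Ioo (Real.arccos b) (Real.pi - Real.arccos b),
      HasDerivAt (fun u => 1 / (4 * Real.sqrt (b ^ 2 - Real.cos u ^ 2)))
        (-(Real.cos u * Real.sin u) / (4 * (b ^ 2 - Real.cos u ^ 2) * Real.sqrt (b ^ 2 - Real.cos u ^ 2))) u :=
    fun u hu => hasDerivAt_hb b u (hgpos u hu)
  have heq : ∀ u ∈ Set.Ioo (Real.arccos b) (Real.pi - Real.arccos b),
      deriv (fun u => 1 / (4 * Real.sqrt (b ^ 2 - Real.cos u ^ 2)))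
        =ᶠ[nhds u] (fun u => -(Real.cos u * Real.sin u) / (4 * (b ^ 2 - Real.cos u ^ 2) * Real.sqrt (b ^ 2 - Real.cos u ^ 2))) :=
    fun u hu => Filter.eventuallyEq_of_mem (Ioo_mem_nhds hu.1 hu.2) (fun v hv => (hd1 v hv).deriv)
  refine convexOn_of_deriv2_nonneg (convex_Ioo _ _) ?_ ?_ ?_ ?_
  · exact fun u hu => (hd1 u hu).continuousAt.continuousWithinAt
  · rw [interior_Ioo]; exact fun u hu => (hd1 u hu).differentiableAt.differentiableWithinAt
  · rw [interior_Ioo]; intro u hu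
    obtain ⟨d, hd, -⟩ := hasDerivAt_hb'_nonneg b u hb0 hb1 (hgpos u hu)
    exact (hd.differentiableAt.congr_of_eventuallyEq (heq u hu)).differentiableWithinAt
  · rw [interior_Ioo]; intro u hu
    obtain ⟨d, hd, hnn⟩ := hasDerivAt_hb'_nonneg b u hb0 hb1 (hgpos u hu)
    show 0 ≤ deriv (deriv _) u
    rw [(heq u hu).deriv_eq, hd.deriv]
    exact hnn

end Summit.HubbardSuperconductivity.HubbardSuperconductivity.Theorems.AnisotropyChord.Transfer.Fibre3

end
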